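import Summits.BirchSwinnertonDyer.Rank1Residual.GaloisImage.WildNineTorsionValuation
import Summits.BirchSwinnertonDyer.Rank1Residual.GaloisImage.ThreeAdicTowerInertiaCriterion
import Literature.NumberTheory.EllipticCurves.VariableChangePoints
import HarnessLib

/-!
# The `3`-adic tower on the WILD locus `v₃(j − 1728) ∈ {1, 2, 4}`: `ρ̄_{E,3}` onto ⟹ `ρ̄_{E,3ⁿ}` onto
# (cell `b2b-bsdres`, team n1011, seat p02 gen 3, OWNERS row T-b10 'wild tower at 3', file F2)

HONEST FRAMING (cell `b2b-bsdres`, run/shared/lean/b2b/bsd-rank1-residual/, verbatim in every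
file): the goal of the cell is to DELETE the COMBINATION-SHAPED residual classes of the
Birch–Swinnerton-Dyer formula for ALL analytic-rank `≤ 1` elliptic curves over `ℚ` — "full BSD
formula for every rank `≤ 1` curve in class `C`" assembled STRICTLY from published theorems — so
that the rank-`≤ 1` remainder becomes exactly the CONSTRUCTION-SHAPED classes, which are TYPED
(missing-input `Prop`s), NOT attempted. This is not "finishing BSD". Team n1011 (N10 / N11, the
additive block X4 ∧ `p = 3`): research route on the CONSTRUCTION-SHAPED class X4; no claim beyond the
stated classes; the label X4 is UNCHANGED by this file; nothing is booked. Theorems only (no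
definition, no named fact).

* §1 `valuation_ratCast_mul_pow_eq_pow` — the place over `3` on rationals:
  `v(q)·v(3)^{v₃(den q)} = v(3)^{v₃(num q)}`.
* §2 `exists_variableChange_normalShape` — every elliptic curve over `ℚ̄` has an equation
  `y² = x³ + A x² + x`, reached by `C = (u, e, −a₁/2, −(a₃ + e·a₁)/2)`, `e` a `2`-torsion abscissa.
* §3 `exists_nineTorsion_csOrdinate_valuation` — for `E/ℚ` with `1 ≤ v₃(j − 1728) = m ≤ 4`: a point
  `Q = (x₀, y₀)` of `E(ℚ̄)` with `9Q = O` whose completed-square ordinate `z = y₀ + (a₁x₀ + a₃)/2` has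
  `v(z)¹⁰⁸·v(3)^{m + 27v₃(den Δ)} = v(3)^{27v₃(num Δ)}` (files `WildShapeValuation`,
  `WildThreeTorsionValuation`, `WildNineTorsionValuation`, pulled back along
  `Literature/…/VariableChangePoints.pointEquiv`; `z = u³·y''`, `v(u)¹² = v(Δ)`).
* §4 **`towerSurj_three_of_surj_of_padicValRat_j_sub`** — `E/ℚ` elliptic (any model),
  `v₃(j(E) − 1728) ∈ {1, 2, 4}`, `ρ̄_{E,3}` onto ⟹ `ρ̄_{E,3ⁿ}` onto for every `n`; Kato's (12.5.2)
  `imageContainsSL2_three_of_surj_of_padicValRat_j_sub`.  Mechanism: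
  `z⁴ ∈ ℚ(E[9])` has valuation with denominator divisible by `27` (`3 ∤ m`) ⟹ `27 ∣ #ρ̄_{E,9}(I_𝔓)`
  ⟹ p02 gen-2 criterion `forall_hasSurjectiveModNGaloisRep_three_pow_of_surj_of_valuation`
  (`#ker(ρ̄₉(I) → ρ̄₃(I)) ≥ 9 > 3` scalars ⟹ first-order inertia witness ⟹ Serre IV-23).

The hypothesis forces additive, potentially good SUPERSINGULAR, WILD reduction at `3`.  Not covered,
honestly: `v₃(j − 1728) = 3` (Elkies' `9`-deficient family, every `v₃(N) = 5` row) and `≥ 5`.  Census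
reading (EVIDENCE, p14 T-b1 engine 1 v1.2): the hypothesis holds on the wild surj(3) X4@3 `r_an = 0`
cells exactly for `v₃(N) = 4` and for the `v₃(N) = 3` cells of Kodaira type `II*`/`IV` — 1 090 of the
1 772 cells whose tower bit needed a mod-`9` certificate.  X4 stays CONSTRUCTION-SHAPED.

References: [SerreAbelianLadic1968] IV-23 Lemma 3; [Serre1972] §1; Silverman *AEC* III.1, Ex. 3.7;
N. Katz (1973) §3.10; N. Elkies, arXiv:math/0612734.
-/

noncomputable section

-- as in `WildShapeValuation`: numerals `x ^ 108` on the value group need a deeper recursion limit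
set_option maxRecDepth 10000

open scoped Classical

open Polynomial WeierstrassCurve

-- pin `Algebra ℚ ℚ̄` as in `GaloisImage/ThreeAdicTowerInertiaCriterion`
attribute [local instance 1001] IntermediateField.algebra'
attribute [local instance 1002] AlgebraicClosure.instAlgebra

local notation "𝕂" => AlgebraicClosure ℚ

namespace Summit.BirchSwinnertonDyer.Rank1Residual.GaloisImage

open Literature.NumberTheory.EllipticCurves Literature.NumberTheory.GaloisRepresentations
  Rat.HeightOneSpectrum

/-! ### §1 The place over `3` on rationals -/

section RatVal

/-- `v(n) = v(3)^{v₃(n)}` for a non-zero natural number `n`. [folklore] -/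
theorem valuation_natCast_eq_pow {n : ℕ} (hn : n ≠ 0) :
    (placeOver 3).valuation (n : AlgebraicClosure ℚ) =
      (placeOver 3).valuation (3 : AlgebraicClosure ℚ) ^ padicValNat 3 n := by
  haveI : Fact (Nat.Prime 3) := ⟨Nat.prime_three⟩
  obtain ⟨k, hk⟩ := pow_padicValNat_dvd (p := 3) (n := n)
  have hk3 : ¬ 3 ∣ k := by
    rintro ⟨l, rfl⟩
    refine pow_succ_padicValNat_not_dvd (p := 3) hn ⟨l, ?_⟩
    rw [pow_succ]; nth_rw 1 [hk]; ring
  have hvk : (placeOver 3).valuation (k : AlgebraicClosure ℚ) = 1 := by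
    have := valuation_placeOver_intCast_eq_one 3 (n := k) (by exact_mod_cast hk3)
    simpa using this
  nth_rw 1 [hk]
  push_cast
  rw [map_mul, map_pow, hvk, mul_one]

/-- `v(z) = v(3)^{v₃(z)}` for a non-zero integer `z`. [folklore] -/
theorem valuation_intCast_eq_pow {z : ℤ} (hz : z ≠ 0) :
    (placeOver 3).valuation (z : AlgebraicClosure ℚ) =
      (placeOver 3).valuation (3 : AlgebraicClosure ℚ) ^ padicValInt 3 z := by
  rw [padicValInt]
  rcases Int.natAbs_eq z with h | h
  · conv_lhs => rw [h, Int.cast_natCast]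
    exact valuation_natCast_eq_pow (Int.natAbs_ne_zero.mpr hz)
  · conv_lhs => rw [h, Int.cast_neg, Int.cast_natCast]
    rw [Valuation.map_neg]
    exact valuation_natCast_eq_pow (Int.natAbs_ne_zero.mpr hz)

/-- **`v(q) · v(3)^{v₃(den q)} = v(3)^{v₃(num q)}`** for a non-zero rational `q` read in `ℚ̄`
(so `v(q) = v(3)^{v₃(q)}` with `v₃(q) = v₃(num) − v₃(den)`). [folklore] -/
theorem valuation_ratCast_mul_pow_eq_pow {q : ℚ} (hq : q ≠ 0) :
    (placeOver 3).valuation (algebraMap ℚ (AlgebraicClosure ℚ) q) *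
        (placeOver 3).valuation (3 : AlgebraicClosure ℚ) ^ padicValNat 3 q.den =
      (placeOver 3).valuation (3 : AlgebraicClosure ℚ) ^ padicValInt 3 q.num := by
  have hnum : q.num ≠ 0 := Rat.num_ne_zero.mpr hq
  have hden : q.den ≠ 0 := q.den_nz
  have hden' : ((q.den : ℚ) : AlgebraicClosure ℚ) ≠ 0 := by exact_mod_cast hden
  rw [eq_ratCast, ← valuation_natCast_eq_pow hden, ← valuation_intCast_eq_pow hnum, ← map_mul]
  congr 1
  have : (q : AlgebraicClosure ℚ) = (q.num : AlgebraicClosure ℚ) / (q.den : AlgebraicClosure ℚ) := by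
    exact_mod_cast (Rat.num_div_den q).symm
  rw [this, div_mul_cancel₀]
  exact_mod_cast hden

/-- `v(q) = v(3)^m` for a rational `q` with `v₃(q) = m ≥ 0`… precisely: if
`padicValRat 3 q = m` (`m : ℕ`) and `q ≠ 0` then `v(q) = v(3)^m`. [folklore] -/
theorem valuation_ratCast_eq_pow_of_padicValRat {q : ℚ} (hq : q ≠ 0) {m : ℕ}
    (hm : padicValRat 3 q = m) :
    (placeOver 3).valuation (algebraMap ℚ (AlgebraicClosure ℚ) q) =
      (placeOver 3).valuation (3 : AlgebraicClosure ℚ) ^ m := by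
  have key := valuation_ratCast_mul_pow_eq_pow hq
  have ht0 : (placeOver 3).valuation (3 : AlgebraicClosure ℚ) ≠ 0 := valuation_three_ne_zero
  have hrel : padicValInt 3 q.num = m + padicValNat 3 q.den := by
    have := hm; rw [padicValRat] at this; omega
  rw [hrel, pow_add] at key
  exact mul_right_cancel₀ (pow_ne_zero _ ht0) key

end RatVal

/-! ### §2 The normal shape `y² = x³ + A x² + x` over `ℚ̄` -/

section NormalShape

variable (E : WeierstrassCurve (AlgebraicClosure ℚ)) [E.IsElliptic]

/-- **Every elliptic curve over `ℚ̄` has an equation `y² = x³ + A·x² + x`** (`a₁ = a₃ = a₆ = 0`,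
`a₄ = 1`): complete the square (`s = −a₁/2`), move a `2`-torsion point `(e, ·)` to the origin
(`r = e` a root of `Ψ₂Sq = 4X³ + b₂X² + 2b₄X + b₆`, `t = −(a₃ + e·a₁)/2`), and rescale by `u` with
`u⁴ = ` the resulting `a₄` (non-zero since `Δ ≠ 0`).  Silverman *AEC* III.1 (Table 3.1).
[cite: SilvermanAEC2009, III.1 Table 3.1] -/
theorem exists_variableChange_normalShape :
    ∃ C : VariableChange (AlgebraicClosure ℚ),
      (C • E).a₁ = 0 ∧ (C • E).a₃ = 0 ∧ (C • E).a₄ = 1 ∧ (C • E).a₆ = 0 ∧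
        C.s = -E.a₁ / 2 ∧ C.t = -(E.a₃ + C.r * E.a₁) / 2 := by
  have h4 : (4 : AlgebraicClosure ℚ) ≠ 0 := by norm_num
  have hnd : E.Ψ₂Sq.natDegree = 3 := E.natDegree_Ψ₂Sq h4
  have hΨ0 : E.Ψ₂Sq ≠ 0 := by
    intro h0; rw [h0, natDegree_zero] at hnd; exact absurd hnd (by norm_num)
  have hdeg : E.Ψ₂Sq.degree ≠ 0 := by
    rw [degree_eq_natDegree hΨ0, hnd]; norm_num
  obtain ⟨e, he⟩ := IsAlgClosed.exists_root E.Ψ₂Sq hdeg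
  have he' : 4 * e ^ 3 + (E.a₁ ^ 2 + 4 * E.a₂) * e ^ 2 + 2 * (2 * E.a₄ + E.a₁ * E.a₃) * e +
      (E.a₃ ^ 2 + 4 * E.a₆) = 0 := by
    have := he
    simp only [IsRoot.def, WeierstrassCurve.Ψ₂Sq, WeierstrassCurve.b₂, WeierstrassCurve.b₄,
      WeierstrassCurve.b₆, eval_add, eval_mul, eval_C, eval_pow, eval_X] at this
    linear_combination this
  set s₁ : AlgebraicClosure ℚ := -E.a₁ / 2 with hs₁
  set t₁ : AlgebraicClosure ℚ := -(E.a₃ + e * E.a₁) / 2 with ht₁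
  set B : AlgebraicClosure ℚ :=
    E.a₄ - s₁ * E.a₃ + 2 * e * E.a₂ - (t₁ + e * s₁) * E.a₁ + 3 * e ^ 2 - 2 * s₁ * t₁ with hB
  -- the polynomial parts of `a₁'`, `a₃'`, `a₆'` vanish
  have p1 : E.a₁ + 2 * s₁ = 0 := by rw [hs₁]; ring
  have p3 : E.a₃ + e * E.a₁ + 2 * t₁ = 0 := by rw [ht₁]; ring
  have p6 : E.a₆ + e * E.a₄ + e ^ 2 * E.a₂ + e ^ 3 - t₁ * E.a₃ - t₁ ^ 2 - e * t₁ * E.a₁ = 0 := by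
    rw [ht₁]; linear_combination (1 / 4 : AlgebraicClosure ℚ) * he'
  -- `B ≠ 0`: otherwise `(1, e, s₁, t₁) • E` has `a₁ = a₃ = a₄ = a₆ = 0`, so `Δ = 0`
  have hB0 : B ≠ 0 := by
    intro hB0
    set C₁ : VariableChange (AlgebraicClosure ℚ) := ⟨1, e, s₁, t₁⟩ with hC₁
    have ha1 : (C₁ • E).a₁ = 0 := by rw [variableChange_a₁, hC₁, p1, mul_zero]
    have ha3 : (C₁ • E).a₃ = 0 := by rw [variableChange_a₃, hC₁, p3, mul_zero]
    have ha4 : (C₁ • E).a₄ = 0 := by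
      rw [variableChange_a₄, hC₁]
      change ↑(1 : (AlgebraicClosure ℚ)ˣ)⁻¹ ^ 4 * B = 0
      rw [hB0, mul_zero]
    have ha6 : (C₁ • E).a₆ = 0 := by rw [variableChange_a₆, hC₁, p6, mul_zero]
    have hΔ : (C₁ • E).Δ = 0 := by
      rw [WeierstrassCurve.Δ, WeierstrassCurve.b₂, WeierstrassCurve.b₄, WeierstrassCurve.b₆,
        WeierstrassCurve.b₈, ha1, ha3, ha4, ha6]
      ring
    exact (C₁ • E).isUnit_Δ.ne_zero hΔ
  obtain ⟨u, hu⟩ := IsAlgClosed.exists_pow_nat_eq B (by norm_num : 0 < 4)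
  have hu0 : u ≠ 0 := by
    rintro rfl; rw [zero_pow (by norm_num)] at hu; exact hB0 hu.symm
  refine ⟨⟨Units.mk0 u hu0, e, s₁, t₁⟩, ?_, ?_, ?_, ?_, rfl, rfl⟩
  · rw [variableChange_a₁]
    change ↑(Units.mk0 u hu0)⁻¹ * (E.a₁ + 2 * s₁) = 0
    rw [p1, mul_zero]
  · rw [variableChange_a₃]
    change ↑(Units.mk0 u hu0)⁻¹ ^ 3 * (E.a₃ + e * E.a₁ + 2 * t₁) = 0
    rw [p3, mul_zero]
  · rw [variableChange_a₄]
    change ↑(Units.mk0 u hu0)⁻¹ ^ 4 * B = 1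
    rw [Units.val_inv_eq_inv_val, Units.val_mk0, ← hu, inv_pow, inv_mul_cancel₀ (pow_ne_zero _ hu0)]
  · rw [variableChange_a₆]
    change ↑(Units.mk0 u hu0)⁻¹ ^ 6 *
      (E.a₆ + e * E.a₄ + e ^ 2 * E.a₂ + e ^ 3 - t₁ * E.a₃ - t₁ ^ 2 - e * t₁ * E.a₁) = 0
    rw [p6, mul_zero]

end NormalShape

/-! ### §3 A `9`-torsion point of `E/ℚ` whose completed-square ordinate has valuation `−m/108`
(relative to the model) -/

section Main

variable (W : WeierstrassCurve ℚ) [W.IsElliptic]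

/-- **The valuation witness.**  For `E/ℚ` with `1 ≤ v₃(j − 1728) = m ≤ 4` there is a geometric point
`Q = (x₀, y₀)` with `9Q = O` whose completed-square ordinate `z = y₀ + (a₁x₀ + a₃)/2` is non-zero and
satisfies `v(z)¹⁰⁸ · v(3)^{m + 27·v₃(den Δ)} = v(3)^{27·v₃(num Δ)}` — i.e. `108·val(z) = 27·v₃(Δ) − m`.
(Normal shape over `ℚ̄` by §2; the shape exponent, a non-canonical `3`-torsion abscissa and the
`9`-torsion coordinates above it by files F1; `z = u³·y''` along
`Literature/…/VariableChangePoints.pointEquiv`; `v(u)¹² = v(Δ)` since the normal shape has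
`v(Δ'') = 1`.) [folklore] -/
theorem exists_nineTorsion_csOrdinate_valuation {m : ℕ} (hm1 : 1 ≤ m) (hm4 : m ≤ 4)
    (hj : padicValRat 3 (W.j - 1728) = m) :
    ∃ (Q : W.geomPoints) (x y : AlgebraicClosure ℚ)
      (h : (W.map (algebraMap ℚ (AlgebraicClosure ℚ))).toAffine.Nonsingular x y),
      Q = .some x y h ∧ (9 : ℤ) • Q = 0 ∧
      y + (algebraMap ℚ (AlgebraicClosure ℚ) W.a₁ * x + algebraMap ℚ (AlgebraicClosure ℚ) W.a₃) / 2
        ≠ 0 ∧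
      (placeOver 3).valuation (y + (algebraMap ℚ (AlgebraicClosure ℚ) W.a₁ * x +
          algebraMap ℚ (AlgebraicClosure ℚ) W.a₃) / 2) ^ 108 *
        (placeOver 3).valuation (3 : AlgebraicClosure ℚ) ^ (m + 27 * padicValNat 3 W.Δ.den) =
      (placeOver 3).valuation (3 : AlgebraicClosure ℚ) ^ (27 * padicValInt 3 W.Δ.num) := by
  -- NB: no `set` for `E := W ⊗ ℚ̄` — abstracting it inside the goal makes unification unfold
  -- `Nonsingular` over `ℚ̄` (time-out); the base change is written out.
  set v := (placeOver 3).valuation with hv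
  set t := v (3 : AlgebraicClosure ℚ) with ht
  have ht0 : t ≠ 0 := valuation_three_ne_zero
  -- §2: normal shape
  obtain ⟨C, h1, h3, h4, h6, hs, htC⟩ := exists_variableChange_normalShape (W.map (algebraMap ℚ 𝕂))
  set E'' := C • W.map (algebraMap ℚ 𝕂) with hE''
  -- the shape exponent from `j`
  have hq0 : W.j - 1728 ≠ 0 := by
    intro h0; rw [h0, padicValRat.zero] at hj; exact_mod_cast (show (m : ℤ) ≠ 0 by omega) hj.symm
  have hjK : v (E''.j - 1728) = t ^ m := by
    have : E''.j - 1728 = algebraMap ℚ 𝕂 (W.j - 1728) := by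
      rw [show E''.j = (W.map (algebraMap ℚ 𝕂)).j from variableChange_j _ _, map_j, map_sub,
        map_ofNat]
    rw [this]
    exact valuation_ratCast_eq_pow_of_padicValRat hq0 hj
  obtain ⟨hα1, -, hΔ1, hα⟩ :=
    valuation_a₂_of_shape_of_j (W := E'') h1 h3 h4 h6 hm1 (hm4.trans (by norm_num)) hjK
  -- a non-canonical `3`-torsion abscissa and a point above it
  obtain ⟨ξ, hξroot, hξ⟩ := exists_isRoot_Ψ₃_wild (W := E'') h1 h3 h4 h6 hm1 hm4 hα
  obtain ⟨η, hη⟩ := IsAlgClosed.exists_pow_nat_eq (ξ ^ 3 + E''.a₂ * ξ ^ 2 + ξ) (by norm_num : 0 < 2)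
  have hPeq : E''.toAffine.Equation ξ η := by
    rw [Affine.equation_iff, h1, h3, h4, h6, hη]; ring
  have hPns : E''.toAffine.Nonsingular ξ η := (Affine.equation_iff_nonsingular ..).mp hPeq
  have hP3 : (3 : ℤ) • (Affine.Point.some ξ η hPns : E''.toAffine.Point) = 0 := by
    refine (zsmul_some_eq_zero_iff_eval_ΨSq E'' hPns 3).mpr ?_
    rw [ΨSq_three, eval_pow, hξroot.eq_zero, zero_pow two_ne_zero]
  -- pull back to `W ⊗ ℚ̄`, divide by `3` there (divisibility of `E(ℚ̄)`), push forward again;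
  -- the group-law bookkeeping is done on Mathlib's `Affine.Point` (the tree's `geomPoints` is a
  -- type synonym of it with a definitionally equal group structure)
  set φ := VariableChange.pointEquiv (W.map (algebraMap ℚ 𝕂)) C with hφ
  set P₀ : (W.map (algebraMap ℚ 𝕂)).toAffine.Point := φ.symm (Affine.Point.some ξ η hPns) with hP₀
  have hP₀3 : (3 : ℤ) • P₀ = 0 := by rw [hP₀, ← map_zsmul, hP3, map_zero]
  obtain ⟨Q₀, hQ₀3⟩ : ∃ Q₀ : (W.map (algebraMap ℚ 𝕂)).toAffine.Point, (3 : ℤ) • Q₀ = P₀ :=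
    W.zsmul_geomPoints_surjective_holds (n := 3) (by norm_num) P₀
  have hQ₀9 : (9 : ℤ) • Q₀ = 0 := by
    rw [show (9 : ℤ) = 3 * 3 by norm_num, mul_smul, hQ₀3, hP₀3]
  have hQ''3 : (3 : ℤ) • φ Q₀ = Affine.Point.some ξ η hPns := by
    rw [← map_zsmul, hQ₀3, hP₀, AddEquiv.apply_symm_apply]
  have hQ''0 : φ Q₀ ≠ 0 := by
    intro h0; rw [h0, smul_zero] at hQ''3; exact Affine.Point.some_ne_zero _ hQ''3.symm
  rcases hQ'' : φ Q₀ with _ | ⟨x'', y'', h''⟩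
  · exact absurd hQ'' hQ''0
  rw [hQ''] at hQ''3
  -- the coordinates of `φ Q₀ = (x'', y'')`: F1 §3
  have hrel : ξ * (E''.Ψ₃.eval x'') ^ 2 = (E''.Φ 3).eval x'' := by
    have := mul_eval_ΨSq_of_zsmul_eq E'' h'' 3 hPns hQ''3
    rwa [ΨSq_three, eval_pow] at this
  have hx'' := valuation_pow_162_eq_of_mul_rel_wild (W := E'') h1 h3 h4 h6 hm1 hm4 hα hrel hξ
  have hy'' := valuation_Y_pow_108_eq_wild (W := E'') h1 h3 h4 h6 hm1 hα h''.left hx''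
  -- back on `W`: `Q₀ = (u²x'' + r, u³y'' + u²s x'' + t)`
  have hQ₀eq : Q₀ = φ.symm (Affine.Point.some x'' y'' h'') := by
    rw [← hQ'', AddEquiv.symm_apply_apply]
  rw [hφ, VariableChange.pointEquiv_symm_apply, VariableChange.pointInv_some] at hQ₀eq
  refine ⟨Q₀, C.ofX x'', C.ofY x'' y'', _, hQ₀eq, hQ₀9, ?_, ?_⟩
  -- `z = u³ y''`
  all_goals
    have hz : C.ofY x'' y'' + (algebraMap ℚ (AlgebraicClosure ℚ) W.a₁ * C.ofX x'' + algebraMap ℚ (AlgebraicClosure ℚ) W.a₃) / 2 =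
        (C.u : AlgebraicClosure ℚ) ^ 3 * y'' := by
      rw [VariableChange.ofY_def, VariableChange.ofX_def, hs, htC, map_a₁, map_a₃]; ring
  · -- `z ≠ 0`
    rw [hz]
    have hvy0 : v y'' ≠ 0 := by
      intro h0; rw [h0, zero_pow (by norm_num), zero_mul] at hy''; exact zero_ne_one hy''
    have hu0 : (C.u : AlgebraicClosure ℚ) ≠ 0 := C.u.ne_zero
    exact mul_ne_zero (pow_ne_zero _ hu0) ((Valuation.ne_zero_iff _).mp hvy0)
  · -- the valuation identity
    rw [hz, map_mul, map_pow]
    -- `v(u)¹² = v(Δ_W)` read in `ℚ̄`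
    have hΔW : W.Δ ≠ 0 := W.isUnit_Δ.ne_zero
    have huΔ : v (C.u : AlgebraicClosure ℚ) ^ 12 = v (algebraMap ℚ (AlgebraicClosure ℚ) W.Δ) := by
      have e1 : E''.Δ = (C.u⁻¹ : 𝕂ˣ) ^ 12 * algebraMap ℚ 𝕂 W.Δ := by
        rw [hE'', variableChange_Δ, map_Δ]
      have := congrArg v e1
      rw [hΔ1, map_mul, map_pow, Units.val_inv_eq_inv_val, map_inv₀] at this
      -- `1 = (v u)⁻¹ ^ 12 * v Δ`
      have hvu0 : v (C.u : AlgebraicClosure ℚ) ≠ 0 := (Valuation.ne_zero_iff _).mpr C.u.ne_zero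
      rw [inv_pow, eq_comm, inv_mul_eq_one₀ (pow_ne_zero _ hvu0)] at this
      exact this
    have hrat := valuation_ratCast_mul_pow_eq_pow (q := W.Δ) hΔW
    rw [← huΔ] at hrat
    -- assemble: `(v u)^{324} (v y'')^{108} t^m t^{27 k₂} = ((v u)^{12} t^{k₂})^{27} (v y''^{108} t^m)`
    calc (v (C.u : AlgebraicClosure ℚ) ^ 3 * v y'') ^ 108 * t ^ (m + 27 * padicValNat 3 W.Δ.den)
        = (v (C.u : AlgebraicClosure ℚ) ^ 12 * t ^ padicValNat 3 W.Δ.den) ^ 27 * (v y'' ^ 108 * t ^ m) := by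
          rw [mul_pow, ← pow_mul, mul_pow, ← pow_mul, ← pow_mul, pow_add,
            show 3 * 108 = 12 * 27 from rfl,
            show 27 * padicValNat 3 W.Δ.den = padicValNat 3 W.Δ.den * 27 from Nat.mul_comm _ _]
          simp only [mul_assoc, mul_comm, mul_left_comm]
      _ = t ^ (27 * padicValInt 3 W.Δ.num) := by
          rw [hrat, hy'', mul_one, ← pow_mul, Nat.mul_comm (padicValInt 3 W.Δ.num) 27]

end Main

/-! ### §4 The tower -/

section Tower

variable (W : WeierstrassCurve ℚ) [W.IsElliptic]

/-- The socket data: for `E/ℚ` with `v₃(j − 1728) = m ∈ {1, 2, 4}` a non-zero `z ∈ ℚ(E[9])` (the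
fourth power of the completed-square ordinate of §3) with `v(z)²⁷ · v(3)^a = v(3)^b`,
`27` coprime to `a − b` (`a − b ≡ m (mod 27)`, `3 ∤ m`). [folklore] -/
theorem exists_mem_divisionField_nine_valuation_pow_27 {m : ℕ} (hm : m = 1 ∨ m = 2 ∨ m = 4)
    (hj : padicValRat 3 (W.j - 1728) = m) :
    ∃ (z : AlgebraicClosure ℚ) (a b : ℕ), z ∈ W.divisionField 9 ∧ z ≠ 0 ∧
      (placeOver 3).valuation z ^ 27 * (placeOver 3).valuation (3 : AlgebraicClosure ℚ) ^ a =
        (placeOver 3).valuation (3 : AlgebraicClosure ℚ) ^ b ∧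
      IsCoprime (27 : ℤ) ((a : ℤ) - b) := by
  have hm1 : 1 ≤ m := by omega
  have hm4 : m ≤ 4 := by omega
  obtain ⟨Q, x, y, h, hQ, hQ9, hz0, hval⟩ := exists_nineTorsion_csOrdinate_valuation W hm1 hm4 hj
  haveI : NeZero (9 : ℕ) := ⟨by norm_num⟩
  have hQ' : Q ∈ geomTorsion W ((9 : ℕ) : ℤ) := (mem_geomTorsion_iff W _ Q).mpr (by exact_mod_cast hQ9)
  obtain ⟨hxL, hyL⟩ := W.mem_divisionField_of_eq_some (n := 9) (T := ⟨Q, hQ'⟩) hQ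
  set z := y + (algebraMap ℚ 𝕂 W.a₁ * x + algebraMap ℚ 𝕂 W.a₃) / 2 with hz
  have hzL : z ∈ W.divisionField 9 := by
    refine add_mem hyL (div_mem (add_mem (mul_mem ?_ hxL) ?_) ?_)
    · exact IntermediateField.algebraMap_mem _ _
    · exact IntermediateField.algebraMap_mem _ _
    · exact IntermediateField.natCast_mem _ 2
  refine ⟨z ^ 4, m + 27 * padicValNat 3 W.Δ.den, 27 * padicValInt 3 W.Δ.num, pow_mem hzL 4,
    pow_ne_zero _ hz0, ?_, ?_⟩
  · rw [map_pow, ← pow_mul]; exact hval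
  · have e : ((m + 27 * padicValNat 3 W.Δ.den : ℕ) : ℤ) - ((27 * padicValInt 3 W.Δ.num : ℕ) : ℤ) =
        (m : ℤ) + 27 * ((padicValNat 3 W.Δ.den : ℤ) - padicValInt 3 W.Δ.num) := by
      push_cast; ring
    rw [e]
    refine IsCoprime.add_mul_left_right ?_ _
    rw [Int.isCoprime_iff_gcd_eq_one]
    rcases hm with rfl | rfl | rfl <;> decide

/-- **THE `3`-ADIC TOWER ON THE WILD LOCUS `v₃(j − 1728) ∈ {1, 2, 4}`.**  Let `E/ℚ` be an elliptic
curve (any Weierstrass model) with `v₃(j(E) − 1728) = m ∈ {1, 2, 4}` — equivalently `v₃(j) ∈ {1, 2}`,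
or `v₃(j) = 3 ∧ v₃(j − 1728) = 4`; such a curve is additive, potentially good supersingular and
wildly ramified at `3` — and suppose `ρ̄_{E,3} : Γ_ℚ → GL₂(𝔽₃)` is onto.  Then `ρ̄_{E,3ⁿ}` is onto for
every `n` (`ρ_{E,3^∞}(Γ_ℚ) = GL₂(ℤ₃)`).  Proof: §3 gives `z ∈ ℚ(E[9])` whose `3`-adic valuation has
denominator divisible by `27`, hence `27 ∣ #ρ̄_{E,9}(I_𝔓)` and the inertia criterion of
`GaloisImage/ThreeAdicTowerInertiaCriterion` (an element of inertia trivial on `E[3]` and non-scalar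
on `E[9]`; Serre IV-23) applies.  NOT covered: `v₃(j − 1728) = 3` (Elkies' `9`-deficient curves live
there) and `v₃(j − 1728) ≥ 5`; `j = 1728` is excluded automatically (`padicValRat 3 0 = 0`, Mathlib's
junk value, is not in `{1, 2, 4}`). [cite: SerreAbelianLadic1968, Ch. IV §3.4, Lemma 3 (IV-23)] -/
theorem towerSurj_three_of_surj_of_padicValRat_j_sub {m : ℕ} (hm : m = 1 ∨ m = 2 ∨ m = 4)
    (hj : padicValRat 3 (W.j - 1728) = m) (hsurj : W.HasSurjectiveModNGaloisRep 3) (n : ℕ) :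
    W.HasSurjectiveModNGaloisRep (3 ^ n : ℕ) := by
  obtain ⟨z, a, b, hzL, hz0, hval, hcop⟩ := exists_mem_divisionField_nine_valuation_pow_27 W hm hj
  exact forall_hasSurjectiveModNGaloisRep_three_pow_of_surj_of_valuation W hsurj hzL hz0 hval hcop
    (dvd_refl 27) n

/-- **Kato's (12.5.2) at `3` on the wild locus**: `v₃(j − 1728) ∈ {1, 2, 4}` and `ρ̄_{E,3}` onto ⟹
the image of `Gal(ℚ̄/ℚ(ζ_{3^∞}))` in `Aut(T₃E)` contains `SL₂(ℤ₃)` (cell binder V20X / N11 tower bit,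
certificate-free on these rows). [cite: Kato2004Asterisque, (12.5.2) (p. 222)] -/
theorem imageContainsSL2_three_of_surj_of_padicValRat_j_sub {m : ℕ} (hm : m = 1 ∨ m = 2 ∨ m = 4)
    (hj : padicValRat 3 (W.j - 1728) = m) (hsurj : W.HasSurjectiveModNGaloisRep 3) :
    Kato2004.ImageContainsSL2 W 3 := by
  obtain ⟨z, a, b, hzL, hz0, hval, hcop⟩ := exists_mem_divisionField_nine_valuation_pow_27 W hm hj
  exact imageContainsSL2_three_of_surj_of_valuation W hsurj hzL hz0 hval hcop (dvd_refl 27)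

end Tower

end Summit.BirchSwinnertonDyer.Rank1Residual.GaloisImage

end
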